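import Summits.CriticalPhenomena.PercolationContinuityZ3.Theorems.PercNearOneGluingNoHeavyQuantFarSunSharpWitAvg
import Summits.CriticalPhenomena.PercolationContinuityZ3.Theorems.PercNearOneGluingNoHeavyQuantFarSunLargeKRing
import HarnessLib

/-!
# FAR beyond trees: **EVERY LAYER OF FAR ON ALL HAIRY CYCLES WITH `K ≥ 17(j+4)` HAIRS** — the sharpened all-layer large-`K` theorem
# `HairyCycle.sunFAR_of_ge_sharp : 2 ≤ j → 17·j + 68 ≤ K → SunFAR K j` (was `1600·j + 81 ≤ K`, …QuantFarSunLargeKLinear, gen 41)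

builds on p205010 (kernel theorem, internal audit signed; external expert review pending)

Support file (`--supports stmt-CriticalPhenomena-4575`), seat `prim-cert-1` (gen 42); memo `prim-cert-1/FROM-prim-cert-1-g42-SHARP-LARGEK.md`.
Same architecture as gen 41 (every-layer conditional assembly `sunFAR_of_witGavg_from_all` + LEMMA 2 on the region `R_j` + LEMMA 1 for `G_avg ≥ 1`),
with the `K`-free LEMMA 1 of `…QuantFarSunSharpWitAvg` (`Σ ≥ (9j+12)/2 ⇒ witGavg ≥ 1`) and a sharper LEMMA 2:

* `HairyCycle.hairV_univ_ge_chernoff` — `F = hairV K h j (range K) ≥ 1 − 4^j e^{−(3/4)Σ}` (Chernoff at `θ = 1/4`);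
* **`HairyCycle.jKF_lt_of_R`** — on `R_j` (`j(F − η) < η(Σ − 2j)`, `η` a least weight, `Σ > 2j`): `j·K·F < Σ(Σ − j)`, `j·K < Σ(Σ + 1)`, `η > 0`
  (`ηK ≤ Σ`; NBU `Σ − j ≤ F(Σ+1)` for the second);
* `four_pow_mul_exp_neg_le` — `4^j e^{−3j} ≤ 1/25` for `j ≥ 2` (`e³ ≥ 20`);
* **`HairyCycle.sunFAR_of_ge_sharp`** — for `j ≥ 2` and `17j + 68 ≤ K`: `SunFAR K j`.  On `R_j` with `K ≥ 17j+68`: if `Σ ≤ 4j` then `jK < 4j(4j+1)`,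
  impossible; if `4j < Σ < (9j+12)/2` then `F ≥ 24/25` and `(24/25)·j(17j+68) ≤ jKF < Σ(Σ−j) < (9j+12)(7j+12)/4`, impossible for `j ≥ 2`;
  so `Σ ≥ (9j+12)/2` and LEMMA 1 applies;
* graph forms **`farRelayRow_hairyCycle_of_ge_sharp`**, **`farRelayRow_ring_of_ge_sharp`** — the body of `Quant.FarRelayRow` at every layer `j ≥ 2` on
  every hairy cycle / ring with `K ≥ 17j + 68` relays (bridges `farRelayRow_{hairyCycle,ring}_of_sunFAR`).
With layers `0, 1, 2` known for all `K` and `K ≤ 11` at every layer (`sunFAR_of_le_eleven`), FAR on hairy cycles / rings is open only for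
`12 ≤ K ≤ 17j + 67` at layers `j ≥ 3`.  No definitions, no sorries, standard axioms.  [this work]
[cite: KozmaNitzan2024, Lemma 2 (p. 6), Conjecture 3 (p. 15)] (context: the lower-tail family FAR serves).
-/

noncomputable section

namespace Summit.CriticalPhenomena.PercolationContinuityZ3.Theorems.HairyCycle

open Finset
open scoped Classical

variable {K : ℕ}

/-! ## LEMMA 2 sharpened -/

/-- **Chernoff lower bound for `F`**: `hairV K h j (range K) ≥ 1 − 4^j·e^{−(3/4)Σ_{k<K} h k}` (`0 ≤ h ≤ 1` on `range K`). [this work] -/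
theorem hairV_univ_ge_chernoff {h : ℕ → ℝ} (hh : ∀ k, k < K → 0 ≤ h k ∧ h k ≤ 1) (j : ℕ) :
    1 - (4 : ℝ) ^ j * Real.exp (-(3 / 4) * ∑ k ∈ range K, h k) ≤ hairV K h j (range K) := by
  have hmass : ∑ k ∈ range K, h k ≤ ∑ k ∈ (range K).filter (fun k => k ∈ range K), h k := by
    have : (range K).filter (fun k => k ∈ range K) = range K := by ext k; simp
    rw [this]
  have hc := countTail_le_chernoff hh (range K) j (θ := 1 / 4) (by norm_num) (by norm_num) hmass
  have htot : hairV K h j (range K) + ∑ Q ∈ (range K).powerset, hairW K h Q * (if (Q ∩ range K).card ≤ j then (1 : ℝ) else 0) = 1 := by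
    unfold hairV
    rw [← Finset.sum_add_distrib]
    calc ∑ Q ∈ (range K).powerset, (hairW K h Q * (if j + 1 ≤ (Q ∩ range K).card then (1 : ℝ) else 0) +
            hairW K h Q * (if (Q ∩ range K).card ≤ j then (1 : ℝ) else 0))
        = ∑ Q ∈ (range K).powerset, hairW K h Q := Finset.sum_congr rfl fun Q _ => by
            by_cases hq : j + 1 ≤ (Q ∩ range K).card
            · rw [if_pos hq, if_neg (by omega)]; ring
            · rw [if_neg hq, if_pos (by omega)]; ring
      _ = 1 := sum_hairW_eq_one h
  have e : Real.exp (-(1 - 1 / 4) * ∑ k ∈ range K, h k) / (1 / 4 : ℝ) ^ j = (4 : ℝ) ^ j * Real.exp (-(3 / 4) * ∑ k ∈ range K, h k) := by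
    rw [one_div_pow, div_div_eq_mul_div, div_one, mul_comm]; norm_num
  rw [e] at hc
  linarith

/-- **LEMMA 2 at layer `j ≥ 1`, sharpened.**  Let `h ∈ [0,1]` (everywhere), `m < K` with `h m ≤ h k` (`k < K`), `Σ := Σ_{k<K} h k > 2j` and the regime
`R_j`: `j·(F − h m) < h m·(Σ − 2j)` (`F = hairV K h j (range K)`).  Then `j·K·F < Σ(Σ − j)`, `j·K < Σ(Σ + 1)` and `0 < h m`. [this work] -/
theorem jKF_lt_of_R {h : ℕ → ℝ} (hh : ∀ k, 0 ≤ h k ∧ h k ≤ 1) {j : ℕ} (hj : 1 ≤ j) {m : ℕ} (hm : m < K)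
    (hmin : ∀ k, k < K → h m ≤ h k) (hSig : (2 * j : ℝ) < ∑ k ∈ range K, h k)
    (hR : j * (hairV K h j (range K) - h m) < h m * (∑ k ∈ range K, h k - 2 * j)) :
    (j : ℝ) * K * hairV K h j (range K) < (∑ k ∈ range K, h k) * (∑ k ∈ range K, h k - j) ∧
      (j : ℝ) * K < (∑ k ∈ range K, h k) * (∑ k ∈ range K, h k + 1) ∧ 0 < h m := by
  set S := ∑ k ∈ range K, h k with hSdef
  set F := hairV K h j (range K) with hFdef
  set η := h m with hηdef
  have hF0 : 0 ≤ F := hairV_nonneg' (fun k _ => hh k) j (range K)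
  have hj1 : (1 : ℝ) ≤ j := by exact_mod_cast hj
  have hη0 : 0 ≤ η := (hh m).1
  have hηpos : 0 < η := by
    by_contra hneg
    have hz : η = 0 := le_antisymm (le_of_not_gt hneg) hη0
    rw [hz] at hR
    nlinarith
  have hηK : η * K ≤ S := by
    have := Finset.sum_le_sum (s := range K) (f := fun _ => η) (g := h) fun k hk => hmin k (Finset.mem_range.1 hk)
    rw [Finset.sum_const, Finset.card_range, nsmul_eq_mul] at this
    rw [hSdef]; linarith
  have hK0 : (0 : ℝ) < K := by exact_mod_cast (show 0 < K by omega)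
  have hjF : (j : ℝ) * F < η * (S - j) := by nlinarith
  have hSj : 0 < S - j := by linarith
  refine ⟨?_, ?_, hηpos⟩
  · -- `jKF < ηK(S − j) ≤ S(S − j)`
    have h1 : (j : ℝ) * F * K < η * (S - j) * K := mul_lt_mul_of_pos_right hjF hK0
    have h2 : η * (S - j) * K ≤ S * (S - j) := by nlinarith
    nlinarith
  · -- NBU: `S − j ≤ F(S+1)`; so `j < η(S+1)` and `jK < ηK(S+1) ≤ S(S+1)`
    have hnbu := sum_sub_le_hairV_univ_mul hh (K := K) j
    rw [← hSdef, ← hFdef] at hnbu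
    have h1a : (j : ℝ) * (S - j) ≤ (j : ℝ) * F * (S + 1) := by nlinarith
    have h1b : (j : ℝ) * F * (S + 1) < η * (S - j) * (S + 1) := by nlinarith
    have h1 : (j : ℝ) * (S - j) < η * (S + 1) * (S - j) := by linarith
    have h2 : (j : ℝ) < η * (S + 1) := lt_of_mul_lt_mul_right h1 hSj.le
    have h3 : (j : ℝ) * K < η * (S + 1) * K := mul_lt_mul_of_pos_right h2 hK0
    have h4 : η * (S + 1) * K ≤ S * (S + 1) := by nlinarith
    linarith

/-- `e⁶ ≥ 400`, hence `4^j e^{−3j} ≤ 1/25` for `j ≥ 2`. [this work] -/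
theorem four_pow_mul_exp_neg_le {j : ℕ} (hj : 2 ≤ j) : (4 : ℝ) ^ j * Real.exp (-(3 * (j : ℝ))) ≤ 1 / 25 := by
  have h1 := Real.exp_one_gt_d9
  have he3 : (20 : ℝ) ≤ Real.exp 3 := by
    have e : Real.exp 3 = Real.exp 1 ^ 3 := by rw [← Real.exp_nat_mul]; norm_num
    rw [e]
    have := pow_le_pow_left₀ (by norm_num) h1.le 3
    have h20 : (20 : ℝ) ≤ (2.7182818283 : ℝ) ^ 3 := by norm_num
    linarith
  -- `x := 4 e^{−3} ∈ [0, 1/5]`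
  set x := (4 : ℝ) * Real.exp (-3) with hx
  have hx0 : 0 ≤ x := by positivity
  have hx5 : x ≤ 1 / 5 := by
    rw [hx, Real.exp_neg]
    have hpos : 0 < Real.exp 3 := Real.exp_pos 3
    rw [← div_eq_mul_inv, div_le_iff₀ hpos]
    linarith
  have e : (4 : ℝ) ^ j * Real.exp (-(3 * (j : ℝ))) = x ^ j := by
    rw [hx, mul_pow, ← Real.exp_nat_mul]; ring_nf
  rw [e]
  calc x ^ j ≤ x ^ 2 := pow_le_pow_of_le_one hx0 (by linarith) hj
    _ ≤ (1 / 5) ^ 2 := pow_le_pow_left₀ hx0 hx5 2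
    _ = 1 / 25 := by norm_num

/-! ## The theorem -/

/-- **EVERY LAYER OF FAR ON ALL HAIRY CYCLES WITH `K ≥ 17(j+4)` HAIRS.**  For every layer `j ≥ 2` and every hair count `K ≥ 17·j + 68`:
`SunFAR K j` — FAR at layer `j` on the sun graph with `K` hairs, all cycle-edge and hair weights (hence, by
`HairyCycle.farRelayRow_hairyCycle_of_sunFAR`, on every hairy cycle with `K` pendant relays).  Unconditional; sharpens
`sunFAR_of_ge_linear` (`K ≥ 1600j + 81`). [this work] -/
theorem sunFAR_of_ge_sharp {j : ℕ} (hj : 2 ≤ j) {K : ℕ} (hK : 17 * j + 68 ≤ K) : SunFAR K j := by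
  have hj1 : 1 ≤ j := le_trans (by norm_num) hj
  have hj' : (2 : ℝ) ≤ j := by exact_mod_cast hj
  have hK2 : 2 ≤ K := by omega
  refine sunFAR_of_witGavg_from_all hj K hK2 (fun K' hK' h hh m hm hmin hS2j hR => ?_) K le_rfl
  -- truncate `h` outside `range K'`
  set h' : ℕ → ℝ := fun k => if k < K' then h k else 0 with hh'def
  have he : ∀ k, k < K' → h' k = h k := fun k hk => by rw [hh'def]; simp only [hk, if_true]
  have hh' : ∀ k, 0 ≤ h' k ∧ h' k ≤ 1 := by
    intro k
    by_cases hk : k < K'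
    · rw [he k hk]; exact hh k hk
    · rw [hh'def]; simp only [hk, if_false]; norm_num
  have hsum : ∑ k ∈ range K', h' k = ∑ k ∈ range K', h k :=
    Finset.sum_congr rfl fun k hk => he k (Finset.mem_range.1 hk)
  have hF : hairV K' h' j (range K') = hairV K' h j (range K') := hairV_congr he j (range K')
  -- LEMMA 2 for `h'`
  have hL2 := jKF_lt_of_R (K := K') hh' hj1 hm (fun k hk => by rw [he m hm, he k hk]; exact hmin k hk)
    (by rw [hsum]; exact hS2j) (by rw [hsum, hF, he m hm]; exact hR)
  rw [hsum, hF, he m hm] at hL2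
  obtain ⟨hjKF, hjK, hηpos⟩ := hL2
  set S := ∑ k ∈ range K', h k with hSdef
  set F := hairV K' h j (range K') with hFdef
  have hS0 : 0 ≤ S := Finset.sum_nonneg fun k hk => (hh k (Finset.mem_range.1 hk)).1
  have hK'r : (17 : ℝ) * j + 68 ≤ K' := by
    have : ((17 * j + 68 : ℕ) : ℝ) ≤ (K' : ℝ) := by exact_mod_cast hK.trans hK'
    push_cast at this; exact this
  -- all hairs alive
  have hhpos : ∀ k, k < K' → 0 < h k ∧ h k ≤ 1 := fun k hk => ⟨lt_of_lt_of_le hηpos (hmin k hk), (hh k hk).2⟩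
  -- `S ≥ (9j+12)/2`
  have hSig : (9 * (j : ℝ) + 12) / 2 ≤ S := by
    by_contra hlt
    push Not at hlt
    rcases le_or_gt S (4 * j) with hS4 | hS4
    · -- `jK' < S(S+1) ≤ 4j(4j+1)`
      have h1 : S * (S + 1) ≤ (4 * j) * (4 * j + 1) := by nlinarith
      have h2 : (j : ℝ) * K' < 4 * j * (4 * j + 1) := lt_of_lt_of_le hjK h1
      have h3 : (j : ℝ) * (17 * j + 68) ≤ (j : ℝ) * K' := by nlinarith
      nlinarith
    · -- `F ≥ 1 − 4^j e^{−3S/4} ≥ 24/25`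
      have hF1 := hairV_univ_ge_chernoff hh j
      rw [← hSdef, ← hFdef] at hF1
      have hexp : (4 : ℝ) ^ j * Real.exp (-(3 / 4) * S) ≤ 1 / 25 := by
        refine le_trans ?_ (four_pow_mul_exp_neg_le hj)
        refine mul_le_mul_of_nonneg_left (Real.exp_le_exp.2 (by linarith)) (by positivity)
      have hF25 : (24 / 25 : ℝ) ≤ F := by linarith
      -- `jK'·(24/25) ≤ jK'F < S(S − j) < Σ₀(Σ₀ − j)`
      have hK'0 : (0 : ℝ) ≤ (j : ℝ) * K' := by positivity
      have h1 : (j : ℝ) * K' * (24 / 25) ≤ (j : ℝ) * K' * F := mul_le_mul_of_nonneg_left hF25 hK'0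
      have h2 : S * (S - j) < ((9 * (j : ℝ) + 12) / 2) * ((9 * (j : ℝ) + 12) / 2 - j) := by nlinarith
      have h3 : (j : ℝ) * (17 * j + 68) * (24 / 25) ≤ (j : ℝ) * K' * (24 / 25) := by nlinarith
      nlinarith
  exact witGavg_ge_one_of_sum_ge_all hhpos hj hSig

/-! ## Graph forms -/

open MeasureTheory
open Literature.Probability.Percolation Literature.Probability.LatticeModels
open Summit.CriticalPhenomena.PercolationContinuityZ3.Theorems.TwoCopy

/-- **FAR at every layer `j ≥ 2` on every hairy cycle with `K ≥ 17j + 68` pendant relays**, all weights. [this work] -/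
theorem farRelayRow_hairyCycle_of_ge_sharp {n L K : ℕ} {cyc : ℕ → Fin n} {base : ℕ → ℕ} {tip : ℕ → Fin n} (H : IsHairyCycle L cyc K base tip)
    {j : ℕ} (hj : 2 ≤ j) (hK : 17 * j + 68 ≤ K) (w : Sym2 (Fin n) → unitInterval)
    (hsupp : ∀ e : Sym2 (Fin n), ¬ e.IsDiag → w e ≠ 0 →
      (∃ i, i < L ∧ e = cycE L cyc i) ∨ (∃ k, k < K ∧ e = hairE cyc base tip k))
    (t : ℝ)
    (hEN : (2 * j : ℝ) < ∑ a ∈ (Finset.range K).image tip, (prodBernoulli w).real (openConn (cyc 0) a))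
    (hcut : ∀ a ∈ (Finset.range K).image tip, (prodBernoulli w).real (openConn (cyc 0) a)ᶜ ≤ t) :
    (prodBernoulli w).real {ω : BondConfig (Fin n) |
      (((Finset.range K).image tip).filter fun a => ω ∈ openConn (cyc 0) a).card ≤ j} ≤ t :=
  farRelayRow_hairyCycle_of_sunFAR H (sunFAR_of_ge_sharp hj hK) w hsupp t hEN hcut

/-- **FAR at every layer `j ≥ 2` on every RING with `K ≥ 17j + 68` relays** (relays at cycle vertices and/or on pendant hairs), all weights
supported on the cycle and proper hair edges. [this work] -/
theorem farRelayRow_ring_of_ge_sharp {n L K : ℕ} {cyc : ℕ → Fin n} {base : ℕ → ℕ} {tip : ℕ → Fin n} (H : IsHairyCycleD L cyc K base tip)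
    {j : ℕ} (hj : 2 ≤ j) (hK : 17 * j + 68 ≤ K) (w : Sym2 (Fin n) → unitInterval)
    (hsupp : ∀ e : Sym2 (Fin n), ¬ e.IsDiag → w e ≠ 0 →
      (∃ i, i < L ∧ e = cycE L cyc i) ∨ (∃ k, k < K ∧ e = hairE cyc base tip k))
    (t : ℝ)
    (hEN : (2 * j : ℝ) < ∑ a ∈ (Finset.range K).image tip, (prodBernoulli w).real (openConn (cyc 0) a))
    (hcut : ∀ a ∈ (Finset.range K).image tip, (prodBernoulli w).real (openConn (cyc 0) a)ᶜ ≤ t) :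
    (prodBernoulli w).real {ω : BondConfig (Fin n) |
      (((Finset.range K).image tip).filter fun a => ω ∈ openConn (cyc 0) a).card ≤ j} ≤ t :=
  farRelayRow_ring_of_sunFAR H (sunFAR_of_ge_sharp hj hK) w hsupp t hEN hcut

end Summit.CriticalPhenomena.PercolationContinuityZ3.Theorems.HairyCycle

end
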